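import Mathlib
import HarnessLib
import Summits.ValiantsHypothesis.ValiantsHypothesis.Theses.MonotoneRestoration
import Literature.Computability.AlgebraicComplexity.ArithCircuit
import Literature.Computability.AlgebraicComplexity.ArithCircuitProofs
import Literature.Computability.AlgebraicComplexity.MonotoneStructure
import Literature.Computability.AlgebraicComplexity.PermanentIrreducible
import Literature.ModelTheory.FiniteModelTheory.CkEquiv
import Summits.ValiantsHypothesis.ValiantsHypothesis.Theorems.MonotoneRestorationMonotoneRestorationQPCosetCount
import Summits.ValiantsHypothesis.ValiantsHypothesis.Theorems.MonotoneRestorationMonotoneRestorationQPSymmetricLB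
import Summits.ValiantsHypothesis.ValiantsHypothesis.Theorems.MonotoneRestorationMonotoneRestorationQPSupportSymmetrisation
import Summits.ValiantsHypothesis.ValiantsHypothesis.Theorems.MonotoneRestorationMonotoneRestorationQPSparseRegime
import Summits.ValiantsHypothesis.ValiantsHypothesis.Theorems.MonotoneRestorationMonotoneRestorationQPBeta
import Literature.Computability.AlgebraicComplexity.SymmetricArithCircuit
import Literature.Computability.AlgebraicComplexity.DawarWilsenach2025Proofs
import Literature.GroupTheory.PermutationGroups.SmallIndexSubgroups
import Summits.ValiantsHypothesis.ValiantsHypothesis.Theorems.MonotoneRestorationQP.Negative.LoadBearing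
import Summits.ValiantsHypothesis.ValiantsHypothesis.Theorems.MonotoneRestorationMonotoneRestorationQPPermSupportCount

/-! TTRL-lite variant V18997 of stmt-ValiantsHypothesis-15886 -/

set_option linter.dupNamespace false

namespace Summit.ValiantsHypothesis.ValiantsHypothesis.Theorems

open Summit.ValiantsHypothesis.ValiantsHypothesis.Theses.MonotoneRestoration
open Literature.Computability.AlgebraicComplexity

/-- TTRL-lite variant V18997 of `stmt-ValiantsHypothesis-15886` (transport `A_X → Alt(Ω)`, the
converse direction of V9): a permutation `ρ` of `Fin n` fixing the finset `X` pointwise is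
`Equiv.Perm.ofSubtype` of its restriction `ρ.subtypePerm _` to the complement `{x // x ∉ X}`, and the
restriction has the same sign (`Equiv.Perm.ofSubtype_subtypePerm`, `Equiv.Perm.sign_subtypePerm`). -/
theorem stub_altFixing_orbit_dichotomy_var18997 :
    ∀ (n : ℕ) (X : Finset (Fin n)) (ρ : Equiv.Perm (Fin n)), (∀ x ∈ X, ρ x = x) →
      ∃ g : Equiv.Perm {x : Fin n // x ∉ X},
        Equiv.Perm.ofSubtype g = ρ ∧ Equiv.Perm.sign g = Equiv.Perm.sign ρ := by
  intro n X ρ hρ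
  -- `ρ` preserves the complement of `X` (it fixes `X` pointwise, hence also `X` setwise).
  have h₁ : ∀ x : Fin n, (ρ x ∉ X) ↔ (x ∉ X) := by
    intro x
    constructor
    · intro hx hxX
      exact hx (by rwa [hρ x hxX])
    · intro hx hρx
      apply hx
      have := hρ (ρ x) hρx
      -- `ρ (ρ x) = ρ x` forces `ρ x = x` by injectivity.
      have hfix : ρ x = x := ρ.injective this
      rwa [← hfix]
  -- every point moved by `ρ` lies outside `X`.
  have h₂ : ∀ x : Fin n, ρ x ≠ x → x ∉ X := fun x hx hxX => hx (hρ x hxX)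
  refine ⟨ρ.subtypePerm h₁, Equiv.Perm.ofSubtype_subtypePerm h₁ h₂, ?_⟩
  exact Equiv.Perm.sign_subtypePerm ρ h₁ h₂

end Summit.ValiantsHypothesis.ValiantsHypothesis.Theorems
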